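import Mathlib.Combinatorics.SimpleGraph.AdjMatrix
import Mathlib.Analysis.Matrix.Order
import Mathlib.Topology.Algebra.InfiniteSum.ENNReal
import Mathlib.Topology.Algebra.InfiniteSum.Real
import Literature.Probability.RandomPlanarGeometry.FaceDGFF
import HarnessLib

/-!
# The Green function of the face walk killed off a finite set: summability, `G = (I − P)⁻¹`, positivity

Companion to `FaceDGFF.lean` (definition request `defn-faceDGFF` of route
`CriticalPhenomena/SAWScalingLimit/SAWDiscreteFlowLine`), which defines the covariance of the face
DGFF as the walk sum

  `faceGreen A f g = Σ' (ω : walk f → g in ℤ²), [supp ω ⊆ A] · 4^{-|ω|}`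

(a real `tsum`, junk value `0` if not summable) — the expected number of visits to `g` before
leaving `A` of the simple random walk on the dual lattice started at `f` (Lawler 1991, §1.5:
`G_A(x,y) = Σ_j P^x{S_j = y, τ > j}`, "finite in all dimensions" as soon as `A ≠ ℤ^d`, and
symmetric "just traverse the path backwards"). This file supplies what the definition file defers:

* `faceGreen_eq_zero_of_not_mem_left/right`, `faceGreen_comm` (any `A`);
* for a finite face set `S : Finset (Site 2)`, with `faceTransition S = P_S = ¼ A_S` the
  substochastic transition matrix of the walk killed off `S` (`A_S` the adjacency matrix of
  `faceDualGraph S`, the graph `ℤ²` induced on `S`):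
  - `summable_faceTransition_pow_apply` — `Σ_n (P_Sⁿ)_{xy} < ∞`, by an explicit SUPERSOLUTION:
    `w(x) = M² − x₀²` (`facePotential`, `M = 1 + Σ_{x∈S}|x₀|`) satisfies `P_S w ≤ w − ½` on `S`
    (`faceTransition_mulVec_facePotential_le`, the lattice form of `¼Δ(M² − x₀²) = −½`), whence
    `Σ_{n<N} P_Sⁿ 𝟙 ≤ 2w ≤ 2M²` uniformly in `N`;
  - `faceGreen_eq_tsum_pow` — `G_S(x,y) = Σ_n (P_Sⁿ)_{xy}` for `x, y ∈ S` (walks of `ℤ²` inside `S`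
    ≃ walks of the induced graph, Mathlib's `Walk.induce`; grouped by length in `ℝ≥0∞`, Mathlib's
    `adjMatrix_pow_apply_eq_card_walk`), and `summable_faceGreen` — the walk sum is summable on
    every finite `A`, for all endpoints;
  - `one_sub_faceTransition_mul_tsum`, `isUnit_one_sub_faceTransition`, `faceGreenMatrix_eq_inv` —
    **`G_S = Σ_n P_Sⁿ = (I − P_S)⁻¹`** on `S × S`, the two Poisson equations
    `(I − P_S)G_S = G_S(I − P_S) = I`, and the pointwise first-step identity `faceGreen_eq_ite_add`;
  - `posSemidef_one_sub_faceTransition` (`vᵀ(I − P_S)v = ‖v‖² − ¼vᵀA_Sv ≥ 0`, degrees `≤ 4`),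
    `posDef_one_sub_faceTransition`, and **`posDef_faceGreenMatrix`**: the Green matrix of a finite
    face set is positive definite — a legitimate non-degenerate Gaussian covariance, which is what
    the law `faceDGFF` and its characteristic functional need (file `FaceDGFFLaw.lean`).

## Design notes

* Four small definitions package the linear algebra (`faceDualGraph`, an `abbrev` so that Mathlib's
  decidability/finiteness instances apply; `faceTransition`; `faceGreenMatrix`; the supersolution
  `facePotential`); everything else is a theorem. No named fact is introduced.
* Normalisation as in `FaceDGFF.lean`: `I − P_S = ¼(4I − A_S)`, so `G_S = 4(−Δ_S)⁻¹` is four times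
  the unit-conductance Dirichlet Green function.
* Not here: the Markov property / harmonic-measure identities for `faceExit`, asymptotics of `G_S`.

## References

* G. F. Lawler, *Intersections of Random Walks*, Birkhäuser 1991, §1.5, pp. 32–33 (Green's function
  `G_A` of the walk killed on leaving `A`: definition as expected visits / path sum, finiteness,
  symmetry; held: `lit read book:lawler1991-intersections-random-walks`). [Lawler1991]
* G. F. Lawler, V. Limic, *Random Walk: A Modern Introduction*, CUP 2010, §4.6 (the same objects in
  matrix form; the source cited by `FaceDGFF.lean`). [LawlerLimic2010]
-/

noncomputable section

open scoped ENNReal Classical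
open SimpleGraph Matrix Finset

namespace Literature.Probability.RandomPlanarGeometry

open Literature.Probability.LatticeModels

/-! ### Elementary properties of the walk sum (any `A`) -/

/-- `G_A(f, g) = 0` if `f ∉ A`: every walk from `f` visits `f`. [cite: Lawler1991, §1.5] -/
theorem faceGreen_eq_zero_of_not_mem_left {A : Set (Site 2)} {f : Site 2} (hf : f ∉ A)
    (g : Site 2) : faceGreen A f g = 0 := by
  have h : ∀ ω : (zdGraph 2).Walk f g,
      (if (∀ x ∈ ω.support, x ∈ A) then ((4 : ℝ)⁻¹) ^ ω.length else 0) = 0 := fun ω =>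
    if_neg fun hall => hf (hall f ω.start_mem_support)
  simp only [faceGreen, h, tsum_zero]

/-- `G_A(f, g) = 0` if `g ∉ A`: every walk to `g` visits `g`. [cite: Lawler1991, §1.5] -/
theorem faceGreen_eq_zero_of_not_mem_right {A : Set (Site 2)} (f : Site 2) {g : Site 2}
    (hg : g ∉ A) : faceGreen A f g = 0 := by
  have h : ∀ ω : (zdGraph 2).Walk f g,
      (if (∀ x ∈ ω.support, x ∈ A) then ((4 : ℝ)⁻¹) ^ ω.length else 0) = 0 := fun ω =>
    if_neg fun hall => hg (hall g ω.end_mem_support)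
  simp only [faceGreen, h, tsum_zero]

/-- **Symmetry** `G_A(f, g) = G_A(g, f)`: traverse the walks backwards (Lawler 1991, §1.5,
"`G_A(x,y) = G_A(y,x)`"). [cite: Lawler1991, §1.5] -/
theorem faceGreen_comm (A : Set (Site 2)) (f g : Site 2) : faceGreen A f g = faceGreen A g f := by
  let e : (zdGraph 2).Walk g f ≃ (zdGraph 2).Walk f g :=
    { toFun := fun ω => ω.reverse
      invFun := fun ω => ω.reverse
      left_inv := fun ω => Walk.reverse_reverse ω
      right_inv := fun ω => Walk.reverse_reverse ω }
  unfold faceGreen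
  rw [← e.tsum_eq]
  refine tsum_congr fun ω => ?_
  have hs : (∀ x ∈ (e ω).support, x ∈ A) ↔ ∀ x ∈ ω.support, x ∈ A := by
    simp only [e, Equiv.coe_fn_mk, Walk.support_reverse, List.mem_reverse]
  have hl : (e ω).length = ω.length := Walk.length_reverse ω
  rw [hl]
  exact if_congr hs rfl rfl

/-! ### The killed walk on a finite face set: dual graph, transition matrix, Green matrix -/

/-- **The dual graph of a finite face set**: the nearest-neighbour graph `ℤ²` induced on `S`
(faces = dual vertices; Mathlib's `SimpleGraph.induce`, a graph on the subtype `↥S`). An `abbrev`,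
so that Mathlib's decidability and finiteness instances apply. [cite: Lawler1991, §1.5] -/
abbrev faceDualGraph (S : Finset (Site 2)) : SimpleGraph S := (zdGraph 2).induce (S : Set (Site 2))

/-- **The transition matrix of the face walk killed off `S`**: `P_S = ¼ A_S`, `A_S` the adjacency
matrix of `faceDualGraph S`; substochastic (row sums `deg_S(x)/4 ≤ 1`), the defect being the
killing at the faces of `S` adjacent to `ℤ² ∖ S`. [cite: Lawler1991, §1.5] -/
def faceTransition (S : Finset (Site 2)) : Matrix S S ℝ :=
  (4 : ℝ)⁻¹ • (faceDualGraph S).adjMatrix ℝ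

/-- **The Green matrix** of a finite face set: the walk-sum Green function `faceGreen ↑S`
restricted to `S × S`. [cite: Lawler1991, §1.5] -/
def faceGreenMatrix (S : Finset (Site 2)) : Matrix S S ℝ :=
  Matrix.of fun x y : S => faceGreen ↑S x y

/-- **The supersolution** `w(x) = M² − x₀²`, `M = 1 + Σ_{z ∈ S} |z₀|`, of the killed walk on `S`:
`P_S w ≤ w − ½` (`faceTransition_mulVec_facePotential_le`). [folklore] -/
def facePotential (S : Finset (Site 2)) (x : S) : ℝ :=
  ((∑ z ∈ S, |((z : Site 2) 0 : ℝ)|) + 1) ^ 2 - (((x : Site 2) 0 : ℤ) : ℝ) ^ 2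

variable (S : Finset (Site 2))

/-- Entries of the Green matrix. [cite: Lawler1991, §1.5] -/
@[simp] theorem faceGreenMatrix_apply (x y : S) : faceGreenMatrix S x y = faceGreen ↑S x y := rfl

/-- Entries of the transition matrix: `¼` between adjacent faces of `S`, `0` otherwise.
[folklore] -/
theorem faceTransition_apply (x y : S) :
    faceTransition S x y = if (zdGraph 2).Adj x y then (4 : ℝ)⁻¹ else 0 := by
  unfold faceTransition
  rw [Matrix.smul_apply, adjMatrix_apply, smul_eq_mul, mul_ite, mul_one, mul_zero]
  rfl

/-- Entries of `P_Sⁿ`: `(P_Sⁿ)_{xy} = 4⁻ⁿ · #{walks x → y of length n inside S}`. [folklore] -/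
theorem faceTransition_pow_apply (n : ℕ) (x y : S) :
    (faceTransition S ^ n) x y =
      ((4 : ℝ)⁻¹) ^ n * Fintype.card {p : (faceDualGraph S).Walk x y | p.length = n} := by
  rw [faceTransition, smul_pow, Matrix.smul_apply, adjMatrix_pow_apply_eq_card_walk, smul_eq_mul]

/-- Entries of `P_Sⁿ` are nonnegative. [folklore] -/
theorem faceTransition_pow_apply_nonneg (n : ℕ) (x y : S) : 0 ≤ (faceTransition S ^ n) x y := by
  rw [faceTransition_pow_apply]; positivity

/-- Entries of `P_S` are nonnegative. [folklore] -/
theorem faceTransition_apply_nonneg (x y : S) : 0 ≤ faceTransition S x y := by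
  simpa using faceTransition_pow_apply_nonneg S 1 x y

/-- `P_S` is entrywise nonnegative, hence monotone as an operator. [folklore] -/
theorem faceTransition_mulVec_mono {u v : S → ℝ} (h : u ≤ v) :
    faceTransition S *ᵥ u ≤ faceTransition S *ᵥ v := by
  intro x
  simp only [Matrix.mulVec, dotProduct]
  exact Finset.sum_le_sum fun y _ =>
    mul_le_mul_of_nonneg_left (h y) (faceTransition_apply_nonneg S x y)

/-- `(P_S u)(x) = ¼ Σ_{y ∼ x, y ∈ S} u(y)`. [folklore] -/
theorem faceTransition_mulVec_apply (u : S → ℝ) (x : S) :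
    (faceTransition S *ᵥ u) x = (4 : ℝ)⁻¹ * ∑ y ∈ (faceDualGraph S).neighborFinset x, u y := by
  rw [faceTransition, Matrix.smul_mulVec, Pi.smul_apply, adjMatrix_mulVec_apply, smul_eq_mul]

/-- The four lattice neighbours of a site: a sum over the `ℤ²`-neighbours of `x` is the sum over
`x ± e₀`, `x ± e₁`. [folklore] -/
theorem sum_neighborFinset_zdGraph_two (x : Site 2) (F : Site 2 → ℝ) :
    ∑ z ∈ (zdGraph 2).neighborFinset x, F z =
      F (x + Pi.single 0 1) + F (x + Pi.single 0 (-1)) + F (x + Pi.single 1 1) +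
        F (x + Pi.single 1 (-1)) := by
  have hf : Function.Injective
      fun p : Fin 2 × Bool => x + (Pi.single p.1 (if p.2 then 1 else -1) : Site 2) :=
    fun p q h => single_signedUnit_injective (add_left_cancel h)
  rw [neighborFinset_zdGraph_eq_image, Finset.sum_image fun p _ q _ h => hf h,
    Fintype.sum_prod_type, Fin.sum_univ_two, Fintype.sum_bool, Fintype.sum_bool]
  simp only [if_true, Bool.false_eq_true, if_false]
  ring

/-- Neighbours in the dual graph of `S` are lattice neighbours. [folklore] -/
theorem map_neighborFinset_faceDualGraph_subset (x : S) :
    ((faceDualGraph S).neighborFinset x).map (Function.Embedding.subtype _) ⊆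
      (zdGraph 2).neighborFinset (x : Site 2) := by
  intro z hz
  rw [Finset.mem_map] at hz
  obtain ⟨y, hy, rfl⟩ := hz
  rw [mem_neighborFinset] at hy ⊢
  exact hy

/-- The dual graph of `S` has degrees at most `4`. [folklore] -/
theorem degree_faceDualGraph_le_four (x : S) : (faceDualGraph S).degree x ≤ 4 := by
  have h := Finset.card_le_card (map_neighborFinset_faceDualGraph_subset S x)
  rw [Finset.card_map, card_neighborFinset_zdGraph_holds] at h
  exact h

/-! ### Supersolution and summability of the Neumann series -/

/-- `|x₀| + 1 ≤ M` for `x ∈ S`. [folklore] -/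
theorem abs_coord_add_one_le (x : S) :
    |(((x : Site 2) 0 : ℤ) : ℝ)| + 1 ≤ (∑ z ∈ S, |((z : Site 2) 0 : ℝ)|) + 1 := by
  have := Finset.single_le_sum (f := fun z : Site 2 => |((z 0 : ℤ) : ℝ)|) (fun z _ => abs_nonneg _)
    x.2
  linarith

/-- The potential is nonnegative on `S`. [folklore] -/
theorem facePotential_nonneg (x : S) : 0 ≤ facePotential S x := by
  have h := abs_coord_add_one_le S x
  have h0 : 0 ≤ |(((x : Site 2) 0 : ℤ) : ℝ)| := abs_nonneg _
  unfold facePotential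
  nlinarith [sq_abs (((x : Site 2) 0 : ℤ) : ℝ)]

/-- The potential is at most `M²`. [folklore] -/
theorem facePotential_le (x : S) : facePotential S x ≤ ((∑ z ∈ S, |((z : Site 2) 0 : ℝ)|) + 1) ^ 2 := by
  unfold facePotential
  nlinarith [sq_nonneg (((x : Site 2) 0 : ℤ) : ℝ)]

/-- **Supersolution inequality** `P_S w ≤ w − ½` on `S` for `w(x) = M² − x₀²`: averaging `M² − z₀²`
over the four lattice neighbours of `x` gives exactly `M² − x₀² − ½` (the discrete form of
`¼ Δ(M² − x₀²) = −½`), and dropping the (nonnegative) terms of the neighbours outside `S` only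
decreases the sum. [folklore] -/
theorem faceTransition_mulVec_facePotential_le (x : S) :
    (faceTransition S *ᵥ facePotential S) x ≤ facePotential S x - 2⁻¹ := by
  set M : ℝ := (∑ z ∈ S, |((z : Site 2) 0 : ℝ)|) + 1 with hM
  set wt : Site 2 → ℝ := fun z => M ^ 2 - ((z 0 : ℤ) : ℝ) ^ 2 with hwt
  have hxM : |(((x : Site 2) 0 : ℤ) : ℝ)| + 1 ≤ M := abs_coord_add_one_le S x
  -- nonnegativity of the potential on the lattice neighbours of `x`
  have hnn : ∀ z ∈ (zdGraph 2).neighborFinset (x : Site 2), 0 ≤ wt z := by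
    intro z hz
    rw [neighborFinset_zdGraph_eq_image, Finset.mem_image] at hz
    obtain ⟨p, -, rfl⟩ := hz
    set s : Site 2 := Pi.single p.1 (if p.2 then 1 else -1) with hs
    have hb : |((s 0 : ℤ) : ℝ)| ≤ 1 := by
      rcases p with ⟨i, b⟩
      fin_cases i <;> cases b <;> simp [hs]
    have hz0 : |((((x : Site 2) + s) 0 : ℤ) : ℝ)| ≤ M :=
      calc |((((x : Site 2) + s) 0 : ℤ) : ℝ)| = |(((x : Site 2) 0 : ℤ) : ℝ) + ((s 0 : ℤ) : ℝ)| := by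
            simp [Pi.add_apply, Int.cast_add]
        _ ≤ |(((x : Site 2) 0 : ℤ) : ℝ)| + 1 := (abs_add_le _ _).trans (by linarith)
        _ ≤ M := hxM
    have hsq : ((((x : Site 2) + s) 0 : ℤ) : ℝ) ^ 2 ≤ M ^ 2 := by
      rw [← sq_abs, ← sq_abs M]
      exact pow_le_pow_left₀ (abs_nonneg _) (hz0.trans (le_abs_self M)) 2
    simp only [hwt]
    linarith
  rw [faceTransition_mulVec_apply]
  -- compare the sum over the neighbours inside `S` with the sum over all four lattice neighbours
  have h1 : ∑ y ∈ (faceDualGraph S).neighborFinset x, facePotential S y =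
      ∑ z ∈ ((faceDualGraph S).neighborFinset x).map (Function.Embedding.subtype _), wt z := by
    rw [Finset.sum_map]
    rfl
  have h2 : ∑ z ∈ ((faceDualGraph S).neighborFinset x).map (Function.Embedding.subtype _), wt z ≤
      ∑ z ∈ (zdGraph 2).neighborFinset (x : Site 2), wt z :=
    Finset.sum_le_sum_of_subset_of_nonneg (map_neighborFinset_faceDualGraph_subset S x)
      fun z hz _ => hnn z hz
  have h3 : ∑ z ∈ (zdGraph 2).neighborFinset (x : Site 2), wt z =
      4 * M ^ 2 - 4 * (((x : Site 2) 0 : ℤ) : ℝ) ^ 2 - 2 := by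
    rw [sum_neighborFinset_zdGraph_two]
    simp only [hwt, Pi.add_apply, Pi.single_apply, Int.cast_add, Int.cast_one, Int.cast_neg,
      Int.cast_zero, if_true, Fin.zero_eq_one_iff, OfNat.ofNat_ne_one, if_false]
    ring
  have h4 := h1.trans_le (h2.trans_eq h3)
  have h5 : facePotential S x = M ^ 2 - (((x : Site 2) 0 : ℤ) : ℝ) ^ 2 := rfl
  rw [h5]
  nlinarith [h4]

/-- **Uniform bound on the partial sums of the Neumann series**, `Σ_{n<N} P_Sⁿ 𝟙 ≤ 2w`, by
induction on `N` from the supersolution inequality and the monotonicity of `P_S`: the expected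
number of steps the killed walk spends in `S` is at most `2M²`. [folklore] -/
theorem sum_range_pow_mulVec_one_le (N : ℕ) (x : S) :
    ((∑ n ∈ Finset.range N, faceTransition S ^ n) *ᵥ fun _ => (1 : ℝ)) x ≤
      2 * facePotential S x := by
  induction N generalizing x with
  | zero =>
      simp only [Finset.range_zero, Finset.sum_empty, Matrix.zero_mulVec, Pi.zero_apply]
      have := facePotential_nonneg S x
      linarith
  | succ N ih =>
      have hsplit : (∑ n ∈ Finset.range (N + 1), faceTransition S ^ n) =
          faceTransition S * (∑ n ∈ Finset.range N, faceTransition S ^ n) + 1 := by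
        rw [Finset.sum_range_succ', pow_zero, Finset.mul_sum]
        simp only [pow_succ']
      rw [hsplit, Matrix.add_mulVec, Matrix.one_mulVec, ← Matrix.mulVec_mulVec, Pi.add_apply]
      have hmono := faceTransition_mulVec_mono S
        (u := (∑ n ∈ Finset.range N, faceTransition S ^ n) *ᵥ fun _ => (1 : ℝ))
        (v := (2 : ℝ) • facePotential S) (fun y => by simpa using ih y) x
      have hpot := faceTransition_mulVec_facePotential_le S x
      rw [Matrix.mulVec_smul, Pi.smul_apply, smul_eq_mul] at hmono
      linarith

/-- Entrywise bound on the partial sums: `Σ_{n<N} (P_Sⁿ)_{xy} ≤ 2M²`. [folklore] -/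
theorem sum_range_pow_apply_le (N : ℕ) (x y : S) :
    ∑ n ∈ Finset.range N, (faceTransition S ^ n) x y ≤
      2 * ((∑ z ∈ S, |((z : Site 2) 0 : ℝ)|) + 1) ^ 2 := by
  have h1 : ∑ n ∈ Finset.range N, (faceTransition S ^ n) x y =
      (∑ n ∈ Finset.range N, faceTransition S ^ n) x y :=
    (Matrix.sum_apply x y _ _).symm
  have h2 : (∑ n ∈ Finset.range N, faceTransition S ^ n) x y ≤
      ((∑ n ∈ Finset.range N, faceTransition S ^ n) *ᵥ fun _ => (1 : ℝ)) x := by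
    simp only [Matrix.mulVec, dotProduct, mul_one]
    refine Finset.single_le_sum (f := fun y' => (∑ n ∈ Finset.range N, faceTransition S ^ n) x y')
      ?_ (Finset.mem_univ y)
    intro y' _
    rw [Matrix.sum_apply]
    exact Finset.sum_nonneg fun n _ => faceTransition_pow_apply_nonneg S n x y'
  have h3 := sum_range_pow_mulVec_one_le S N x
  have h4 := facePotential_le S x
  linarith

/-- **Summability of the Neumann series** `Σ_n (P_Sⁿ)_{xy}` for a finite face set `S` (the killed
walk leaves a finite set almost surely, with finite expected exit time). [cite: Lawler1991, §1.5] -/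
theorem summable_faceTransition_pow_apply (x y : S) :
    Summable fun n : ℕ => (faceTransition S ^ n) x y :=
  summable_of_sum_range_le (fun n => faceTransition_pow_apply_nonneg S n x y)
    (fun N => sum_range_pow_apply_le S N x y)

/-- **Neumann series / first-step identity**: `(I − P_S) · Σ_n P_Sⁿ = I`. [folklore] -/
theorem one_sub_faceTransition_mul_tsum :
    (1 - faceTransition S) * (Matrix.of fun x y : S => ∑' n : ℕ, (faceTransition S ^ n) x y) = 1 := by
  ext x y
  have key : ∑' n : ℕ, (faceTransition S ^ n) x y =
      (1 : Matrix S S ℝ) x y + ∑ z, faceTransition S x z * ∑' n : ℕ, (faceTransition S ^ n) z y := by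
    rw [(summable_faceTransition_pow_apply S x y).tsum_eq_zero_add, pow_zero]
    congr 1
    have h1 : ∀ n : ℕ, (faceTransition S ^ (n + 1)) x y =
        ∑ z, faceTransition S x z * (faceTransition S ^ n) z y := fun n => by
      rw [pow_succ', Matrix.mul_apply]
    calc ∑' n : ℕ, (faceTransition S ^ (n + 1)) x y
        = ∑' n : ℕ, ∑ z, faceTransition S x z * (faceTransition S ^ n) z y := tsum_congr h1
      _ = ∑ z, ∑' n : ℕ, faceTransition S x z * (faceTransition S ^ n) z y :=
          Summable.tsum_finsetSum (f := fun z (n : ℕ) => faceTransition S x z * (faceTransition S ^ n) z y)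
            (fun z _ => (summable_faceTransition_pow_apply S z y).mul_left _)
      _ = ∑ z, faceTransition S x z * ∑' n : ℕ, (faceTransition S ^ n) z y :=
          Finset.sum_congr rfl fun z _ => (summable_faceTransition_pow_apply S z y).tsum_mul_left _
  rw [Matrix.sub_mul, Matrix.one_mul, Matrix.sub_apply, Matrix.of_apply, Matrix.mul_apply]
  simp only [Matrix.of_apply]
  linarith

/-- `I − P_S` is invertible. [folklore] -/
theorem isUnit_one_sub_faceTransition : IsUnit (1 - faceTransition S) :=
  (Matrix.isUnit_iff_isUnit_det _).2
    (Matrix.isUnit_det_of_right_inverse (one_sub_faceTransition_mul_tsum S))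

/-- `(I − P_S)⁻¹ = Σ_n P_Sⁿ`. [folklore] -/
theorem inv_one_sub_faceTransition :
    (1 - faceTransition S)⁻¹ = Matrix.of fun x y : S => ∑' n : ℕ, (faceTransition S ^ n) x y :=
  Matrix.inv_eq_right_inv (one_sub_faceTransition_mul_tsum S)

/-! ### From walk sums to matrix powers -/

/-- Walks of the dual graph `ℤ²[S]` between two faces of `S` are the lattice walks with support in
`S` (Mathlib's `Walk.induce` / `Walk.map`), with the same length. [folklore] -/
theorem exists_walkEquiv (x y : S) :
    ∃ e : (faceDualGraph S).Walk x y ≃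
        {ω : (zdGraph 2).Walk x y // ∀ v ∈ ω.support, v ∈ (S : Set (Site 2))},
      ∀ ω', (e ω').1.length = ω'.length := by
  have hsupp : ∀ ω' : (faceDualGraph S).Walk x y,
      ∀ v ∈ (ω'.map (Embedding.induce (S : Set (Site 2))).toHom).support, v ∈ (S : Set (Site 2)) := by
    intro ω' v hv
    rw [Walk.support_map] at hv
    obtain ⟨w, -, rfl⟩ := List.mem_map.1 hv
    exact w.2
  have hinj := Walk.map_injective_of_injective (G := faceDualGraph S)
    (G' := zdGraph 2) (f := (Embedding.induce (S : Set (Site 2))).toHom)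
    (Embedding.induce (G := zdGraph 2) (S : Set (Site 2))).injective x y
  refine ⟨{ toFun := fun ω' => ⟨ω'.map (Embedding.induce (S : Set (Site 2))).toHom, hsupp ω'⟩
            invFun := fun ω => ω.1.induce (S : Set (Site 2)) ω.2
            left_inv := fun ω' => hinj (Walk.map_induce _ _)
            right_inv := fun ω => Subtype.ext (Walk.map_induce _ _) },
    fun ω' => Walk.length_map _ _⟩

/-- Grouping the walks of `ℤ²[S]` by length: `Σ_{ω : x → y in ℤ²[S]} 4^{-|ω|} = Σ_n (P_Sⁿ)_{xy}` in
`ℝ≥0∞`. [folklore] -/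
theorem tsum_walk_faceDualGraph_eq (x y : S) :
    (∑' ω' : (faceDualGraph S).Walk x y, ((4 : ℝ≥0∞)⁻¹) ^ ω'.length) =
      ∑' n : ℕ, ENNReal.ofReal ((faceTransition S ^ n) x y) := by
  rw [← (Equiv.sigmaFiberEquiv fun ω' : (faceDualGraph S).Walk x y => ω'.length).tsum_eq,
    ENNReal.tsum_sigma']
  refine tsum_congr fun n => ?_
  rw [tsum_fintype]
  have : ∀ ω : {ω' : (faceDualGraph S).Walk x y // ω'.length = n},
      ((4 : ℝ≥0∞)⁻¹) ^
          ((Equiv.sigmaFiberEquiv fun ω' : (faceDualGraph S).Walk x y => ω'.length) ⟨n, ω⟩).length =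
        ((4 : ℝ≥0∞)⁻¹) ^ n := fun ω => by
    rw [Equiv.sigmaFiberEquiv_apply, ω.2]
  simp only [this, Finset.sum_const, Finset.card_univ, nsmul_eq_mul]
  rw [faceTransition_pow_apply, ENNReal.ofReal_mul (by positivity), ENNReal.ofReal_pow (by positivity),
    ENNReal.ofReal_inv_of_pos (by norm_num), ENNReal.ofReal_ofNat, ENNReal.ofReal_natCast, mul_comm]
  rfl

/-- **The walk-sum Green function is the Neumann series**: for `x, y ∈ S`,
`G_S(x, y) = Σ_n (P_Sⁿ)_{xy}` (grouping the killed walks by length; Tonelli in `ℝ≥0∞`) — Lawler's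
`G_A(x,y) = Σ_j P^x{S_j = y, τ > j}`. [cite: Lawler1991, §1.5] -/
theorem faceGreen_eq_tsum_pow (x y : S) :
    faceGreen ↑S x y = ∑' n : ℕ, (faceTransition S ^ n) x y := by
  set Fe : (zdGraph 2).Walk x y → ℝ≥0∞ := fun ω =>
    if (∀ v ∈ ω.support, v ∈ (S : Set (Site 2))) then ((4 : ℝ≥0∞)⁻¹) ^ ω.length else 0 with hFe
  obtain ⟨e, he⟩ := exists_walkEquiv S x y
  have hE : ∑' ω, Fe ω = ∑' ω' : (faceDualGraph S).Walk x y, ((4 : ℝ≥0∞)⁻¹) ^ ω'.length := by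
    have h1 : ∑' ω, Fe ω =
        ∑' ω : {ω : (zdGraph 2).Walk x y // ∀ v ∈ ω.support, v ∈ (S : Set (Site 2))},
          ((4 : ℝ≥0∞)⁻¹) ^ ω.1.length := by
      refine Eq.trans (tsum_congr fun ω => ?_)
        (tsum_subtype {ω : (zdGraph 2).Walk x y | ∀ v ∈ ω.support, v ∈ (S : Set (Site 2))}
          (fun ω => ((4 : ℝ≥0∞)⁻¹) ^ ω.length)).symm
      simp [hFe, Set.indicator]
    rw [h1, ← e.tsum_eq]
    exact tsum_congr fun ω' => by rw [he]
  have hsum := summable_faceTransition_pow_apply S x y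
  have hE2 : ∑' ω, Fe ω = ENNReal.ofReal (∑' n : ℕ, (faceTransition S ^ n) x y) := by
    rw [hE, tsum_walk_faceDualGraph_eq,
      ENNReal.ofReal_tsum_of_nonneg (fun n => faceTransition_pow_apply_nonneg S n x y) hsum]
  have hne : ∀ ω, Fe ω ≠ ∞ := fun ω => by
    simp only [hFe]
    split_ifs
    · exact ENNReal.pow_ne_top (ENNReal.inv_ne_top.2 (by norm_num))
    · exact ENNReal.zero_ne_top
  have hF : faceGreen ↑S x y = ∑' ω, (Fe ω).toReal := by
    unfold faceGreen
    refine tsum_congr fun ω => ?_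
    simp only [hFe]
    split_ifs
    · rw [ENNReal.toReal_pow, ENNReal.toReal_inv, ENNReal.toReal_ofNat]
    · simp
  calc faceGreen ↑S x y = ∑' ω, (Fe ω).toReal := hF
    _ = (∑' ω, Fe ω).toReal := (ENNReal.tsum_toReal_eq hne).symm
    _ = ∑' n : ℕ, (faceTransition S ^ n) x y := by
      rw [hE2, ENNReal.toReal_ofReal (tsum_nonneg fun n => faceTransition_pow_apply_nonneg S n x y)]

/-- **Summability of the killed walk sum** defining `faceGreen A f g`, for a finite set `A` and all
endpoints (the walk on `ℤ²` killed off a finite set has a finite expected number of visits to every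
site; for `f ∉ A` or `g ∉ A` the family is identically zero). [cite: Lawler1991, §1.5] -/
theorem summable_faceGreen {A : Set (Site 2)} (hA : A.Finite) (f g : Site 2) :
    Summable fun ω : (zdGraph 2).Walk f g =>
      if (∀ x ∈ ω.support, x ∈ A) then ((4 : ℝ)⁻¹) ^ ω.length else 0 := by
  obtain ⟨S, rfl⟩ : ∃ S : Finset (Site 2), (S : Set (Site 2)) = A := ⟨hA.toFinset, hA.coe_toFinset⟩
  by_cases hf : f ∈ S
  swap
  · refine (summable_zero).congr fun ω => ?_
    rw [if_neg fun hall => hf (hall f ω.start_mem_support)]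
  by_cases hg : g ∈ S
  swap
  · refine (summable_zero).congr fun ω => ?_
    rw [if_neg fun hall => hg (hall g ω.end_mem_support)]
  -- both endpoints in `S`: compare with the finite `ℝ≥0∞` sum
  set x : S := ⟨f, hf⟩
  set y : S := ⟨g, hg⟩
  set Fe : (zdGraph 2).Walk f g → ℝ≥0∞ := fun ω =>
    if (∀ v ∈ ω.support, v ∈ (S : Set (Site 2))) then ((4 : ℝ≥0∞)⁻¹) ^ ω.length else 0 with hFe
  obtain ⟨e, he⟩ := exists_walkEquiv S x y
  have hE : ∑' ω, Fe ω = ∑' ω' : (faceDualGraph S).Walk x y, ((4 : ℝ≥0∞)⁻¹) ^ ω'.length := by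
    have h1 : ∑' ω, Fe ω =
        ∑' ω : {ω : (zdGraph 2).Walk f g // ∀ v ∈ ω.support, v ∈ (S : Set (Site 2))},
          ((4 : ℝ≥0∞)⁻¹) ^ ω.1.length := by
      refine Eq.trans (tsum_congr fun ω => ?_)
        (tsum_subtype {ω : (zdGraph 2).Walk f g | ∀ v ∈ ω.support, v ∈ (S : Set (Site 2))}
          (fun ω => ((4 : ℝ≥0∞)⁻¹) ^ ω.length)).symm
      simp [hFe, Set.indicator]
    rw [h1, ← e.tsum_eq]
    exact tsum_congr fun ω' => by rw [he]
  have hE2 : ∑' ω, Fe ω ≠ ∞ := by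
    rw [hE, tsum_walk_faceDualGraph_eq,
      ← ENNReal.ofReal_tsum_of_nonneg (fun n => faceTransition_pow_apply_nonneg S n x y)
        (summable_faceTransition_pow_apply S x y)]
    exact ENNReal.ofReal_ne_top
  refine (ENNReal.summable_toReal hE2).congr fun ω => ?_
  simp only [hFe]
  split_ifs
  · rw [ENNReal.toReal_pow, ENNReal.toReal_inv, ENNReal.toReal_ofNat]
  · simp

/-! ### Positivity -/

/-- Weighted handshake: `Σ_i Σ_{j ∼ i} g(j) = Σ_j deg(j) g(j)` in the dual graph. [folklore] -/
theorem sum_sum_neighborFinset_eq (g : S → ℝ) :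
    ∑ i, ∑ j ∈ (faceDualGraph S).neighborFinset i, g j =
      ∑ j, ((faceDualGraph S).degree j : ℝ) * g j := by
  have key : ∀ i : S, ∑ j ∈ (faceDualGraph S).neighborFinset i, g j =
      ∑ j, (faceDualGraph S).adjMatrix ℝ i j * g j := fun i => by
    rw [← adjMatrix_mulVec_apply]
    rfl
  have hsymm : ∀ i j : S, (faceDualGraph S).adjMatrix ℝ i j = (faceDualGraph S).adjMatrix ℝ j i :=
    fun i j => (congrFun (congrFun (transpose_adjMatrix (faceDualGraph S) (α := ℝ)) i) j).symm
  have hdeg : ∀ j : S, ∑ i, (faceDualGraph S).adjMatrix ℝ j i = (faceDualGraph S).degree j :=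
    fun j => by
    have h := adjMatrix_mulVec_const_apply (G := faceDualGraph S) (α := ℝ) (a := 1) (v := j)
    rw [mul_one] at h
    rw [← h]
    simp [Matrix.mulVec, dotProduct]
  simp only [key]
  rw [Finset.sum_comm]
  refine Finset.sum_congr rfl fun j _ => ?_
  rw [← hdeg j, Finset.sum_mul]
  exact Finset.sum_congr rfl fun i _ => by rw [hsymm i j]

/-- **AM–GM bound for the adjacency form**: `vᵀ A_S v ≤ Σ_i deg(i) v_i² ≤ 4 ‖v‖²`. [folklore] -/
theorem dotProduct_adjMatrix_mulVec_le (v : S → ℝ) :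
    v ⬝ᵥ (faceDualGraph S).adjMatrix ℝ *ᵥ v ≤ 4 * (v ⬝ᵥ v) := by
  have h1 : v ⬝ᵥ (faceDualGraph S).adjMatrix ℝ *ᵥ v =
      ∑ i, ∑ j ∈ (faceDualGraph S).neighborFinset i, v i * v j := by
    simp only [dotProduct, adjMatrix_mulVec_apply, Finset.mul_sum]
  have h2 : ∑ i, ∑ j ∈ (faceDualGraph S).neighborFinset i, v i * v j ≤
      ∑ i, ∑ j ∈ (faceDualGraph S).neighborFinset i, (v i ^ 2 + v j ^ 2) / 2 :=
    Finset.sum_le_sum fun i _ => Finset.sum_le_sum fun j _ => by nlinarith [sq_nonneg (v i - v j)]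
  have h3 : ∑ i, ∑ j ∈ (faceDualGraph S).neighborFinset i, (v i ^ 2 + v j ^ 2) / 2 =
      (∑ i, ((faceDualGraph S).degree i : ℝ) * v i ^ 2) / 2 +
        (∑ i, ∑ j ∈ (faceDualGraph S).neighborFinset i, v j ^ 2) / 2 := by
    simp only [Finset.sum_div, Finset.sum_add_distrib, add_div]
    congr 1
    refine Finset.sum_congr rfl fun i _ => ?_
    rw [Finset.sum_const, card_neighborFinset_eq_degree, nsmul_eq_mul, mul_div_assoc]
  have h4 : ∑ i, ∑ j ∈ (faceDualGraph S).neighborFinset i, v j ^ 2 =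
      ∑ j, ((faceDualGraph S).degree j : ℝ) * v j ^ 2 :=
    sum_sum_neighborFinset_eq S fun j => v j ^ 2
  have h5 : ∑ i, ((faceDualGraph S).degree i : ℝ) * v i ^ 2 ≤ ∑ i, 4 * v i ^ 2 :=
    Finset.sum_le_sum fun i _ => mul_le_mul_of_nonneg_right
      (by exact_mod_cast degree_faceDualGraph_le_four S i) (sq_nonneg _)
  have h6 : ∑ i, 4 * v i ^ 2 = 4 * (v ⬝ᵥ v) := by
    rw [← Finset.mul_sum]
    simp only [dotProduct, sq]
  linarith [h1, h2, h3, h4, h5, h6]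

/-- `I − P_S` is symmetric. [folklore] -/
theorem isHermitian_one_sub_faceTransition : (1 - faceTransition S).IsHermitian := by
  rw [Matrix.IsHermitian, Matrix.conjTranspose_eq_transpose_of_trivial, Matrix.transpose_sub,
    Matrix.transpose_one, faceTransition, Matrix.transpose_smul, transpose_adjMatrix]

/-- **`I − P_S = ¼(−Δ_S)` is positive semidefinite**: `vᵀ(I − P_S)v = ‖v‖² − ¼ vᵀA_Sv ≥ 0`.
[folklore] -/
theorem posSemidef_one_sub_faceTransition : (1 - faceTransition S).PosSemidef := by
  refine PosSemidef.of_dotProduct_mulVec_nonneg (isHermitian_one_sub_faceTransition S) fun v => ?_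
  have h := dotProduct_adjMatrix_mulVec_le S v
  rw [star_trivial, Matrix.sub_mulVec, Matrix.one_mulVec, dotProduct_sub, faceTransition,
    Matrix.smul_mulVec, dotProduct_smul, smul_eq_mul]
  linarith

/-- **`I − P_S` is positive definite** (positive semidefinite and invertible). [folklore] -/
theorem posDef_one_sub_faceTransition : (1 - faceTransition S).PosDef :=
  (posSemidef_one_sub_faceTransition S).posDef_iff_isUnit.2 (isUnit_one_sub_faceTransition S)

/-! ### The Green matrix -/

/-- **`G_S = (I − P_S)⁻¹`**: the walk-sum Green function restricted to `S × S` is the inverse of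
`I − P_S` (`G_S = Σ_n P_Sⁿ` is Lawler's `Σ_j P^x{S_j = y, τ > j}`; the inverse is the Neumann
series). [cite: Lawler1991, §1.5] -/
theorem faceGreenMatrix_eq_inv : faceGreenMatrix S = (1 - faceTransition S)⁻¹ := by
  rw [inv_one_sub_faceTransition]
  ext x y
  simp only [faceGreenMatrix_apply, Matrix.of_apply]
  exact faceGreen_eq_tsum_pow S x y

/-- `(I − P_S) G_S = I` (discrete Poisson equation in the first variable).
[cite: Lawler1991, §1.5] -/
theorem one_sub_faceTransition_mul_faceGreenMatrix :
    (1 - faceTransition S) * faceGreenMatrix S = 1 := by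
  rw [faceGreenMatrix_eq_inv,
    Matrix.mul_nonsing_inv _ ((Matrix.isUnit_iff_isUnit_det _).1 (isUnit_one_sub_faceTransition S))]

/-- `G_S (I − P_S) = I` (discrete Poisson equation in the second variable).
[cite: Lawler1991, §1.5] -/
theorem faceGreenMatrix_mul_one_sub_faceTransition :
    faceGreenMatrix S * (1 - faceTransition S) = 1 := by
  rw [faceGreenMatrix_eq_inv,
    Matrix.nonsing_inv_mul _ ((Matrix.isUnit_iff_isUnit_det _).1 (isUnit_one_sub_faceTransition S))]

/-- **The Green matrix of a finite face set is positive definite** (in particular a legitimate,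
non-degenerate Gaussian covariance). [cite: Lawler1991, §1.5] -/
theorem posDef_faceGreenMatrix : (faceGreenMatrix S).PosDef := by
  rw [faceGreenMatrix_eq_inv]
  exact (posDef_one_sub_faceTransition S).inv

/-- The Green matrix is positive semidefinite. [cite: Lawler1991, §1.5] -/
theorem posSemidef_faceGreenMatrix : (faceGreenMatrix S).PosSemidef :=
  (posDef_faceGreenMatrix S).posSemidef

/-- The Green matrix is symmetric. [cite: Lawler1991, §1.5] -/
theorem faceGreenMatrix_transpose : (faceGreenMatrix S)ᵀ = faceGreenMatrix S := by
  ext x y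
  simp only [Matrix.transpose_apply, faceGreenMatrix_apply]
  exact faceGreen_comm _ _ _

/-- **First-step (Poisson) identity for the Green function**, pointwise form: for `x, y ∈ S`,
`G_S(x, y) = δ_{xy} + ¼ Σ_{x' ∼ x, x' ∈ S} G_S(x', y)`. [cite: Lawler1991, §1.5] -/
theorem faceGreen_eq_ite_add (x y : S) :
    faceGreen ↑S x y = (if x = y then 1 else 0) +
      (4 : ℝ)⁻¹ * ∑ z ∈ (faceDualGraph S).neighborFinset x, faceGreen ↑S z y := by
  have h := congrFun (congrFun (one_sub_faceTransition_mul_faceGreenMatrix S) x) y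
  rw [Matrix.sub_mul, Matrix.one_mul, Matrix.sub_apply, faceGreenMatrix_apply, Matrix.mul_apply,
    Matrix.one_apply] at h
  have h2 : ∑ z, faceTransition S x z * faceGreenMatrix S z y =
      (4 : ℝ)⁻¹ * ∑ z ∈ (faceDualGraph S).neighborFinset x, faceGreen ↑S z y := by
    rw [neighborFinset_eq_filter, Finset.sum_filter, Finset.mul_sum]
    refine Finset.sum_congr rfl fun z _ => ?_
    rw [faceTransition_apply, faceGreenMatrix_apply]
    simp
  rw [h2] at h
  linarith

end Literature.Probability.RandomPlanarGeometry
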